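import Literature.Geometry.Lorentzian.KerrCylinderParameterCloseness
import Literature.Geometry.Lorentzian.InteriorKerrGluingInterpolation
import HarnessLib

/-!
# The Kerr-cylinder second fundamental form is `C^k`-close to the Schwarzschild one:
# `O(|m − M| + |a|)`

Support file (all results proved; no named facts) for the named fact `LiMei.interiorKerrGluing`
(`InteriorKerrGluing.lean`; J. Li, H. Mei, *A construction of collapsing spacetimes in vacuum*,
Comm. Math. Phys. 378 (2020) = arXiv:2005.01249, Prop. 4.1). Companion of
`KerrCylinderParameterCloseness.lean` (the metric half): here the second-fundamental-form half of
"`‖(ḡ_{m,a⃗} − ḡ_{m₀}, π̄_{m,a⃗} − π̄_{m₀})‖_{C^k} ≤ C(|m − m₀| + |a⃗|)`" (p. 22).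

* `cylKRep` and `cylK₀_apply_eq_cylKRep` — **the second fundamental form of the Kerr cylinder in
  closed form**: by the chart formula `K_ν(v, w) = g(DN v + Γ(N)(dψ v), dψ w)`
  (`OpensChart.secondFundamentalForm_eq_of_repr`) and the explicit inverse Kerr–Schild metric
  (`Kerr.sharp_smoothMetric`, `g(g♯p, w) = p(w)`),
  `K(v, w) = g(D(n∘ψ) v, dψ w) + ½ Kos_g(ψ)(n, dψ v)(dψ w)` with the Koszul form of the metric
  components — an expression in `g_{m,a}`, `Dg_{m,a}`, `ψ_a`, `dψ_a` and the unit normal `n_{m,a}`,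
  valid wherever `Δ_{m,a}(r₀) < 0`;
* `cylK₀_zero_spin` — at `(m, a) = (M, 0)` (`0 < r₀ < 2M`) it is the Schwarzschild tensor `k̄_M` of
  Li–Mei (4.1) (`kbarRep`) on `{1 < ‖y‖}`;
* `contDiffOn_cylK₀₃` — joint smoothness of `(m, a, y) ↦ K` (through the closed form: the metric,
  its derivative, the cylinder map, its differential and the unit normal are jointly smooth);
* `cylK₀_isometry` — rotations act by precomposition;
* `exists_norm_iteratedFDeriv_cylK_sub_kbarRep_le` — **the estimate** for the `k`-half, and
  `nearSchwarzschildCylinder_kerrCylinderDatum` — **both halves**: the Kerr-cylinder datum is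
  `C(|m − M| + |a|)`-close in `C^k(A)` to the Schwarzschild cylinder, uniformly in the rotation;
* `nearSchwarzschildCylinder_preGluedDatum_of_parameters` — consequently (with
  `nearSchwarzschildCylinder_interpolate`) the pre-glued datum `D̃` of the first step is
  `C(ε + |m − M| + |a|)`-close whenever `D` is `ε`-close: Li–Mei's "`(g̃, π̃)` is also `ε`-close to
  `(ḡ_{m₀}, π̄_{m₀})` … if `|m − m₀| + |a⃗| < C₀ε`" (p. 22), constants uniform in the parameters.

## References

* J. Li, H. Mei, *A construction of collapsing spacetimes in vacuum*, Comm. Math. Phys. 378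
  (2020), arXiv:2005.01249, §4, (4.1)–(4.2) and proof of Prop. 4.1, p. 22 (key `LiMei2020`).
* B. O'Neill, *Semi-Riemannian geometry* (1983), Ch. 4, Lemma 4.1 ff. (key `ONeill1983`).
-/

noncomputable section

open Bundle Set TopologicalSpace Manifold Module Filter Function Metric
open scoped Manifold ContDiff Topology RealInnerProductSpace

namespace Literature.Geometry.Lorentzian

/-! ### Shortcut instances

As in `KerrCylinderParameterCloseness.lean`: typeclass synthesis on the normed spaces of
multilinear forms is slow in this import closure; the shortcuts are the canonical instances. -/

attribute [local instance] instNormedAddCommGroupBilinE3 instNormedSpaceBilinE3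
  instNormedAddCommGroupBilinE4 instNormedSpaceBilinE4

/-- Shortcut: the space of trilinear forms on `E4` is a normed group (canonical instance). -/
local instance instNormedAddCommGroupTrilinE4 :
    NormedAddCommGroup (E4 →L[ℝ] E4 →L[ℝ] E4 →L[ℝ] ℝ) :=
  ContinuousLinearMap.toNormedAddCommGroup

/-- Shortcut: the space of trilinear forms on `E4` is a normed space (canonical instance). -/
local instance instNormedSpaceTrilinE4 : NormedSpace ℝ (E4 →L[ℝ] E4 →L[ℝ] E4 →L[ℝ] ℝ) :=
  ContinuousLinearMap.toNormedSpace

namespace LiMei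

/-! ### The second fundamental form of the Kerr cylinder in closed form -/

/-- **Closed form of the second fundamental form of the Kerr cylinder frame** (sign convention
`K(v, w) = +g(D_v ν, dψ w)`): with `ψ = kerrCylMap r₀ a τ₀ R`, `dψ = kerrCylDeriv`, the unit normal
`n = kerrCylUnitNormal m a` and `G = Kerr.bilin m a`,
`K_y(v, w) = G(ψ y)(D(n ∘ ψ)_y v, dψ_y w) + ½ (DG(ψ y)(dψ v)(n, dψ w) + DG(ψ y)(n)(dψ w, dψ v) −
DG(ψ y)(dψ w)(dψ v, n))` (the Koszul/Christoffel term after `g(g♯p, ·) = p`). O'Neill 1983, Ch. 4,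
Lemma 4.1; Li–Mei arXiv:2005.01249, (4.1)–(4.2). [cite: LiMei2020, (4.1)–(4.2)] -/
def cylKRep (m a r₀ τ₀ : ℝ) (R : E3 →ₗᵢ[ℝ] E3) (y v w : E3) : ℝ :=
  Kerr.bilin m a (kerrCylMap r₀ a τ₀ R y)
      (fderiv ℝ (fun z : E3 ↦ kerrCylUnitNormal m a (kerrCylMap r₀ a τ₀ R z)) y v)
      (kerrCylDeriv r₀ a R y w) +
    2⁻¹ * (fderiv ℝ (Kerr.bilin m a) (kerrCylMap r₀ a τ₀ R y) (kerrCylDeriv r₀ a R y v)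
          (kerrCylUnitNormal m a (kerrCylMap r₀ a τ₀ R y)) (kerrCylDeriv r₀ a R y w) +
        fderiv ℝ (Kerr.bilin m a) (kerrCylMap r₀ a τ₀ R y)
          (kerrCylUnitNormal m a (kerrCylMap r₀ a τ₀ R y)) (kerrCylDeriv r₀ a R y w)
          (kerrCylDeriv r₀ a R y v) -
        fderiv ℝ (Kerr.bilin m a) (kerrCylMap r₀ a τ₀ R y) (kerrCylDeriv r₀ a R y w)
          (kerrCylDeriv r₀ a R y v) (kerrCylUnitNormal m a (kerrCylMap r₀ a τ₀ R y)))

/-- On the Kerr cylinder `g(g♯dr, g♯dr) = Δ(r₀)/Σ < 0` as soon as `Δ_{m,a}(r₀) < 0` (no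
subextremality needed; `0 < r₀`, `y ≠ 0`). [cite: ONeill1995, Ch. 2, §2.5] -/
theorem bilin_radiusSharp_self_neg_of_delta_neg {m a r₀ : ℝ} (hr₀ : 0 < r₀)
    (hΔ : r₀ ^ 2 - 2 * m * r₀ + a ^ 2 < 0) (τ₀ : ℝ) (R : E3 →ₗᵢ[ℝ] E3) {y : E3} (hy : y ≠ 0) :
    Kerr.bilin m a (kerrCylMap r₀ a τ₀ R y) (Kerr.radiusSharp m a (kerrCylMap r₀ a τ₀ R y))
      (Kerr.radiusSharp m a (kerrCylMap r₀ a τ₀ R y)) < 0 := by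
  have hx : 0 < Kerr.radius a (kerrCylMap r₀ a τ₀ R y) := by
    rw [radius_kerrCylMap hr₀.le a τ₀ R hy]; exact hr₀
  rw [Kerr.bilin_radiusSharp_self m hx, radius_kerrCylMap hr₀.le a τ₀ R hy]
  exact div_neg_of_neg_of_pos hΔ (Kerr.blSigma_spatial_pos hx)

/-- **The second fundamental form of the Kerr cylinder equals its closed form** wherever
`Δ_{m,a}(r₀) < 0` (`0 < r₀`, `y ≠ 0`): `cylK₀ m a r₀ τ₀ R y v w = cylKRep m a r₀ τ₀ R y v w`
(chart formula `OpensChart.secondFundamentalForm_eq_of_repr`, `Kerr.sharp_smoothMetric`,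
`Kerr.bilin_coSharp`). [cite: ONeill1983, Ch. 4, Lemma 4.1] -/
theorem cylK₀_apply_eq_cylKRep [Kerr.Facts] {m a r₀ : ℝ} (hr₀ : 0 < r₀)
    (hΔ : r₀ ^ 2 - 2 * m * r₀ + a ^ 2 < 0) (τ₀ : ℝ) (R : E3 →ₗᵢ[ℝ] E3) {y : E3} (hy : y ≠ 0)
    (v w : E3) : cylK₀ m a hr₀ τ₀ R y v w = cylKRep m a r₀ τ₀ R y v w := by
  haveI : (Kerr.smoothMetric m a 0).HasLeviCivita := PseudoRiemannianMetric.hasLeviCivita _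
  have hf : ∀ z, (cylFrame hr₀ a τ₀ R z : E4) = kerrCylMap r₀ a τ₀ R (z : E3) := fun _ ↦ rfl
  -- the chart formula at a point `y'` of the punctured space
  have key : ∀ y' : cylDomain,
      (Kerr.smoothMetric m a 0).secondFundamentalForm 𝓘(ℝ, E3) (cylFrame hr₀ a τ₀ R)
        (fun z ↦ kerrCylUnitNormal m a (cylFrame hr₀ a τ₀ R z : E4)) y' v w =
      cylKRep m a r₀ τ₀ R y' v w := by
    intro y'
    have hy' : (y' : E3) ≠ 0 := y'.2
    have hx : 0 < Kerr.radius a (kerrCylMap r₀ a τ₀ R y') := by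
      rw [radius_kerrCylMap hr₀.le a τ₀ R hy']; exact hr₀
    have hq := bilin_radiusSharp_self_neg_of_delta_neg hr₀ hΔ τ₀ R hy'
    have hN : DifferentiableAt ℝ (fun z : E3 ↦ kerrCylUnitNormal m a (kerrCylMap r₀ a τ₀ R z)) y' :=
      ((contDiffAt_kerrCylUnitNormal hx hq (n := 1)).comp (y' : E3)
        (contDiffAt_kerrCylMap r₀ a τ₀ R hy')).differentiableAt one_ne_zero
    rw [OpensChart.secondFundamentalForm_eq_of_repr
        (g := (Kerr.smoothMetric m a 0).toPseudoRiemannianMetric) (G := Kerr.bilin m a)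
        (Kerr.smoothMetric_val m a 0) hf
        (ν := fun z ↦ kerrCylUnitNormal m a (cylFrame hr₀ a τ₀ R z : E4))
        (N := fun z : E3 ↦ kerrCylUnitNormal m a (kerrCylMap r₀ a τ₀ R z)) (fun z ↦ rfl)
        (differentiableAt_kerrCylMap r₀ a τ₀ R hy') hN (Kerr.differentiableAt_bilin m a _) v w,
      fderiv_kerrCylMap r₀ a τ₀ R hy']
    -- the same computation with all vectors read in `E4`
    have e2 : Kerr.bilin m a (kerrCylMap r₀ a τ₀ R y')
        (fderiv ℝ (fun z : E3 ↦ kerrCylUnitNormal m a (kerrCylMap r₀ a τ₀ R z)) y' v +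
          OpensChart.christoffel (Kerr.smoothMetric m a 0).toPseudoRiemannianMetric (Kerr.bilin m a)
            (cylFrame hr₀ a τ₀ R y') (kerrCylUnitNormal m a (kerrCylMap r₀ a τ₀ R y'))
            (kerrCylDeriv r₀ a R y' v))
        (kerrCylDeriv r₀ a R y' w) = cylKRep m a r₀ τ₀ R y' v w := by
      rw [map_add, add_apply, OpensChart.christoffel_apply, Kerr.sharp_smoothMetric]
      simp only [coe_cylFrame]
      rw [Kerr.bilin_coSharp m a hx]
      simp only [LinearMap.smul_apply, OpensChart.koszulForm_apply, smul_eq_mul, cylKRep]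
    exact e2
  exact (cylK₀_apply m a hr₀ τ₀ R hy v w).trans (key ⟨y, hy⟩)

/-- **At `(m, a) = (M, 0)` the second fundamental form of the Kerr cylinder is the Schwarzschild
tensor `k̄_M` of Li–Mei (4.1)** on `{1 < ‖y‖}` (`0 < r₀ < 2M`), for every rotation `R`
(through the exact Kerr-cylinder datum and `IsKerrCylinderOn.eq_gbarRep_kbarRep_of_zero_spin`).
[cite: LiMei2020, (4.1)] -/
theorem cylK₀_zero_spin [Kerr.Facts] {M r₀ : ℝ} (hr₀ : 0 < r₀) (h2M : r₀ < 2 * M) (τ₀ : ℝ)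
    (R : E3 →ₗᵢ[ℝ] E3) {y : E3} (hy : 1 < ‖y‖) (v w : E3) :
    cylK₀ M 0 hr₀ τ₀ R y v w = kbarRep M r₀ y v w := by
  obtain ⟨δ, hδ, hbox⟩ := kerrBox hr₀ h2M
  obtain ⟨ha, h₁, h₂⟩ := hbox M 0 (by rw [sub_self, abs_zero, add_zero]; exact hδ.le)
  have hys : y ∈ Kerr.slice 0 1 := by
    rw [Kerr.mem_slice_zero_iff, max_eq_left zero_le_one]; exact hy
  have h := (IsKerrCylinderOn.eq_gbarRep_kbarRep_of_zero_spin hr₀ h2M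
    (isKerrCylinderOn_kerrCylinderDatum ha h₁ h₂ τ₀ R) ⟨y, hys⟩ hy v w).2
  have hk := kerrCylinderDatum_k_apply_of_le ha h₁ h₂ τ₀ R hy.le v w
  exact hk.symm.trans h

/-! ### Joint smoothness in `(m, a, ·)` of the ingredients of the closed form -/

end LiMei

namespace Kerr

/-- The Boyer–Lindquist radius on the slice, `(a, y) ↦ r(a, (0, y))`, is jointly `C^n` where
`r > 0`. [folklore] -/
theorem contDiffAt_radius_slice₂ {p : ℝ × E3} (hp : 0 < radius p.1 (E4.ofTimeSpace 0 p.2))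
    {n : ℕ∞ω} : ContDiffAt ℝ n (fun q : ℝ × E3 ↦ radius q.1 (E4.ofTimeSpace 0 q.2)) p := by
  have hg := contDiffAt_radius₂ (p := (p.1, E4.ofTimeSpace 0 p.2)) hp (n := n)
  have hf : ContDiffAt ℝ n (fun q : ℝ × E3 ↦ (q.1, E4.ofTimeSpace 0 q.2)) p :=
    contDiffAt_fst.prodMk ((E4.contDiff_ofTimeSpace 0).contDiffAt.comp p contDiffAt_snd)
  have h := hg.comp p hf
  exact h

/-- `(a, y) ↦ Σ̃(a, y) = 2r² − ‖y‖² + a²` is jointly `C^n` where `r > 0`. [folklore] -/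
theorem contDiffAt_blSigma₂ {p : ℝ × E3} (hp : 0 < radius p.1 (E4.ofTimeSpace 0 p.2))
    {n : ℕ∞ω} : ContDiffAt ℝ n (fun q : ℝ × E3 ↦ blSigma q.1 q.2) p := by
  unfold blSigma
  exact ((contDiffAt_const.mul ((contDiffAt_radius_slice₂ hp).pow 2)).sub
    (contDiffAt_snd.norm_sq ℝ)).add (contDiffAt_fst.pow 2)

/-- **`(a, y) ↦ ∇r(a, y)` is jointly `C^n` where `r > 0`.** [folklore] -/
theorem contDiffAt_radiusGradVec₂ {p : ℝ × E3} (hp : 0 < radius p.1 (E4.ofTimeSpace 0 p.2))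
    {n : ℕ∞ω} : ContDiffAt ℝ n (fun q : ℝ × E3 ↦ radiusGradVec q.1 q.2) p := by
  unfold radiusGradVec
  have hr := contDiffAt_radius_slice₂ hp (n := n)
  have hS := contDiffAt_blSigma₂ hp (n := n)
  have hne : radius p.1 (E4.ofTimeSpace 0 p.2) * blSigma p.1 p.2 ≠ 0 :=
    mul_ne_zero hp.ne' (blSigma_pos hp).ne'
  have h2 : ContDiffAt ℝ n (fun q : ℝ × E3 ↦ q.2 2) p :=
    ((EuclideanSpace.proj (𝕜 := ℝ) (2 : Fin 3)).contDiff.comp contDiff_snd).contDiffAt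
  exact ((hr.mul hS).inv hne).smul (((hr.pow 2).smul contDiffAt_snd).add
    (((contDiffAt_fst.pow 2).mul h2).smul contDiffAt_const))

/-- **`(a, x) ↦ ℓ♯(a, x)` is jointly `C^n` where `r > 0`** (components `±ℓ_μ`). [folklore] -/
theorem contDiffAt_nullVector₂ {p : ℝ × E4} (hp : 0 < radius p.1 p.2) {n : ℕ∞ω} :
    ContDiffAt ℝ n (fun q : ℝ × E4 ↦ nullVector q.1 q.2) p := by
  refine contDiffAt_euclidean.mpr fun μ ↦ ?_
  by_cases hμ : μ = 0
  · subst hμ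
    have e : (fun q : ℝ × E4 ↦ nullVector q.1 q.2 0) = fun q ↦ -nullCovectorFun q.1 q.2 0 := by
      funext q; simp [nullVector]
    rw [e]
    exact (contDiffAt_nullCovectorFun₂ hp 0).neg
  · have e : (fun q : ℝ × E4 ↦ nullVector q.1 q.2 μ) = fun q ↦ nullCovectorFun q.1 q.2 μ := by
      funext q; simp [nullVector, hμ]
    rw [e]
    exact contDiffAt_nullCovectorFun₂ hp μ

/-- **`(M, a, x) ↦ H = M r³/(r⁴ + a²z²)` is jointly `C^n` where `r > 0`** (linear in `M`).
[cite: KerrSchild1965, §3] -/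
theorem contDiffAt_scalarH₃ {q : ℝ × ℝ × E4} (hq : 0 < radius q.2.1 q.2.2) {n : ℕ∞ω} :
    ContDiffAt ℝ n (fun q : ℝ × ℝ × E4 ↦ scalarH q.1 q.2.1 q.2.2) q := by
  have e : (fun q : ℝ × ℝ × E4 ↦ scalarH q.1 q.2.1 q.2.2) = fun q ↦ q.1 * scalarH 1 q.2.1 q.2.2 := by
    funext q; unfold scalarH; ring
  rw [e]
  exact contDiffAt_fst.mul ((contDiffAt_scalarH₂ 1 (p := q.2) hq).comp q contDiffAt_snd)

/-- **`(M, a, x) ↦ g♯dr` is jointly `C^n` where `r > 0`.** [folklore] -/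
theorem contDiffAt_radiusSharp₃ {q : ℝ × ℝ × E4} (hq : 0 < radius q.2.1 q.2.2) {n : ℕ∞ω} :
    ContDiffAt ℝ n (fun q : ℝ × ℝ × E4 ↦ radiusSharp q.1 q.2.1 q.2.2) q := by
  unfold radiusSharp
  have hsp : 0 < radius q.2.1 (E4.ofTimeSpace 0 (E4.spatial q.2.2)) := by
    rwa [radius_ofTimeSpace_spatial]
  have hg : ContDiffAt ℝ n (fun q : ℝ × ℝ × E4 ↦ radiusGradVec q.2.1 (E4.spatial q.2.2)) q := by
    have h1 := contDiffAt_radiusGradVec₂ (p := (q.2.1, E4.spatial q.2.2)) hsp (n := n)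
    have h2 : ContDiffAt ℝ n (fun q : ℝ × ℝ × E4 ↦ (q.2.1, E4.spatial q.2.2)) q :=
      contDiffAt_snd.fst.prodMk (E4.spatial.contDiff.contDiffAt.comp q contDiffAt_snd.snd)
    have h := h1.comp q h2
    exact h
  have hl : ContDiffAt ℝ n (fun q : ℝ × ℝ × E4 ↦ nullVector q.2.1 q.2.2) q :=
    (contDiffAt_nullVector₂ (p := q.2) hq).comp q contDiffAt_snd
  exact (E4.spaceEmbed.contDiff.contDiffAt.comp q hg).sub
    ((contDiffAt_const.mul (contDiffAt_scalarH₃ hq)).smul hl)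

/-- **`(M, a, x) ↦ Dg_{M,a}(x)` is jointly `C^n` where `r > 0`** (parametric derivative of the
jointly smooth metric, `ContDiffAt.fderiv`). [cite: KerrSchild1965, §3] -/
theorem contDiffAt_fderiv_bilin₃ {q : ℝ × ℝ × E4} (hq : 0 < radius q.2.1 q.2.2) {n : ℕ∞ω} :
    ContDiffAt ℝ n (fun q : ℝ × ℝ × E4 ↦ fderiv ℝ (bilin q.1 q.2.1) q.2.2) q := by
  have hunc : ContDiffAt ℝ (n + 1)
      (uncurry fun (q : ℝ × ℝ × E4) (x : E4) ↦ bilin q.1 q.2.1 x) (q, q.2.2) := by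
    have e : uncurry (fun (q : ℝ × ℝ × E4) (x : E4) ↦ bilin q.1 q.2.1 x) =
        (fun r : ℝ × ℝ × E4 ↦ bilin r.1 r.2.1 r.2.2) ∘
          fun r : (ℝ × ℝ × E4) × E4 ↦ (r.1.1, r.1.2.1, r.2) := rfl
    rw [e]
    exact (contDiffAt_bilin₃ (q := (q.1, q.2.1, q.2.2)) hq).comp (q, q.2.2)
      ((contDiff_fst.comp contDiff_fst).prodMk
        ((contDiff_fst.comp (contDiff_snd.comp contDiff_fst)).prodMk contDiff_snd)).contDiffAt
  exact hunc.fderiv contDiffAt_snd.snd le_rfl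

end Kerr

namespace LiMei

/-- **`(m, a, x) ↦ n_{m,a}(x)` (the unit normal field of the Kerr cylinders) is jointly `C^n`**
where `r > 0` and `g(g♯dr, g♯dr) < 0`. [folklore] -/
theorem contDiffAt_kerrCylUnitNormal₃ {q : ℝ × ℝ × E4} (hq : 0 < Kerr.radius q.2.1 q.2.2)
    (hneg : Kerr.bilin q.1 q.2.1 q.2.2 (Kerr.radiusSharp q.1 q.2.1 q.2.2)
      (Kerr.radiusSharp q.1 q.2.1 q.2.2) < 0) {n : ℕ∞ω} :
    ContDiffAt ℝ n (fun q : ℝ × ℝ × E4 ↦ kerrCylUnitNormal q.1 q.2.1 q.2.2) q := by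
  unfold kerrCylUnitNormal
  have hrs := Kerr.contDiffAt_radiusSharp₃ hq (n := n)
  have hB : ContDiffAt ℝ n (fun q : ℝ × ℝ × E4 ↦ Kerr.bilin q.1 q.2.1 q.2.2
      (Kerr.radiusSharp q.1 q.2.1 q.2.2) (Kerr.radiusSharp q.1 q.2.1 q.2.2)) q :=
    ((Kerr.contDiffAt_bilin₃ hq).clm_apply hrs).clm_apply hrs
  have hpos : 0 < -Kerr.bilin q.1 q.2.1 q.2.2 (Kerr.radiusSharp q.1 q.2.1 q.2.2)
      (Kerr.radiusSharp q.1 q.2.1 q.2.2) := by linarith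
  exact ((hB.neg.sqrt hpos.ne').inv (Real.sqrt_pos.2 hpos).ne').smul hrs

/-- The Kerr discriminant at the cylinder radius is negative near `(M, 0)`: an open condition.
[folklore] -/
theorem isOpen_delta_neg (r₀ : ℝ) : IsOpen {p : ℝ × ℝ | r₀ ^ 2 - 2 * p.1 * r₀ + p.2 ^ 2 < 0} :=
  isOpen_lt (by fun_prop) continuous_const

/-- **`(m, a, y) ↦ n_{m,a}(ψ_a(y))` is jointly `C^n`** off the origin where `Δ_{m,a}(r₀) < 0`
(`0 < r₀`). [folklore] -/
theorem contDiffAt_unitNormal_cyl₃ {r₀ : ℝ} (hr₀ : 0 < r₀) (τ₀ : ℝ) (R : E3 →ₗᵢ[ℝ] E3)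
    {q : ℝ × ℝ × E3} (hy : q.2.2 ≠ 0) (hΔ : r₀ ^ 2 - 2 * q.1 * r₀ + q.2.1 ^ 2 < 0) {n : ℕ∞ω} :
    ContDiffAt ℝ n
      (fun q : ℝ × ℝ × E3 ↦ kerrCylUnitNormal q.1 q.2.1 (kerrCylMap r₀ q.2.1 τ₀ R q.2.2)) q := by
  have hx : 0 < Kerr.radius q.2.1 (kerrCylMap r₀ q.2.1 τ₀ R q.2.2) := by
    rw [radius_kerrCylMap hr₀.le q.2.1 τ₀ R hy]; exact hr₀
  have hg := contDiffAt_kerrCylUnitNormal₃ (n := n)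
    (q := (q.1, q.2.1, kerrCylMap r₀ q.2.1 τ₀ R q.2.2)) hx
    (bilin_radiusSharp_self_neg_of_delta_neg hr₀ hΔ τ₀ R hy)
  have hM : ContDiffAt ℝ n (fun q : ℝ × ℝ × E3 ↦ kerrCylMap r₀ q.2.1 τ₀ R q.2.2) q :=
    (contDiffAt_kerrCylMap₂ hr₀.ne' τ₀ R (q := q.2) hy).comp q contDiffAt_snd
  have hf : ContDiffAt ℝ n
      (fun q : ℝ × ℝ × E3 ↦ (q.1, q.2.1, kerrCylMap r₀ q.2.1 τ₀ R q.2.2)) q :=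
    contDiffAt_fst.prodMk (contDiffAt_snd.fst.prodMk hM)
  have h := hg.comp q hf
  exact h

/-- **`(m, a, y) ↦ D(n_{m,a} ∘ ψ_a)(y)` is jointly `C^n`** off the origin where `Δ_{m,a}(r₀) < 0`
(parametric derivative, `ContDiffAt.fderiv`). [folklore] -/
theorem contDiffAt_fderiv_unitNormal_cyl₃ {r₀ : ℝ} (hr₀ : 0 < r₀) (τ₀ : ℝ) (R : E3 →ₗᵢ[ℝ] E3)
    {q : ℝ × ℝ × E3} (hy : q.2.2 ≠ 0) (hΔ : r₀ ^ 2 - 2 * q.1 * r₀ + q.2.1 ^ 2 < 0) {n : ℕ∞ω} :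
    ContDiffAt ℝ n (fun q : ℝ × ℝ × E3 ↦
      fderiv ℝ (fun z : E3 ↦ kerrCylUnitNormal q.1 q.2.1 (kerrCylMap r₀ q.2.1 τ₀ R z)) q.2.2) q := by
  have hunc : ContDiffAt ℝ (n + 1)
      (uncurry fun (q : ℝ × ℝ × E3) (z : E3) ↦
        kerrCylUnitNormal q.1 q.2.1 (kerrCylMap r₀ q.2.1 τ₀ R z)) (q, q.2.2) := by
    have e : uncurry (fun (q : ℝ × ℝ × E3) (z : E3) ↦
        kerrCylUnitNormal q.1 q.2.1 (kerrCylMap r₀ q.2.1 τ₀ R z)) =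
        (fun r : ℝ × ℝ × E3 ↦ kerrCylUnitNormal r.1 r.2.1 (kerrCylMap r₀ r.2.1 τ₀ R r.2.2)) ∘
          fun r : (ℝ × ℝ × E3) × E3 ↦ (r.1.1, r.1.2.1, r.2) := rfl
    rw [e]
    exact (contDiffAt_unitNormal_cyl₃ hr₀ τ₀ R (q := (q.1, q.2.1, q.2.2)) hy hΔ).comp (q, q.2.2)
      ((contDiff_fst.comp contDiff_fst).prodMk
        ((contDiff_fst.comp (contDiff_snd.comp contDiff_fst)).prodMk contDiff_snd)).contDiffAt
  exact hunc.fderiv contDiffAt_snd.snd le_rfl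

/-- **The closed form `(m, a, y) ↦ cylKRep m a r₀ τ₀ R y v w` is jointly smooth** off the origin
where `Δ_{m,a}(r₀) < 0` (`0 < r₀`). [cite: LiMei2020, Prop. 4.1] -/
theorem contDiffAt_cylKRep₃ {r₀ : ℝ} (hr₀ : 0 < r₀) (τ₀ : ℝ) (R : E3 →ₗᵢ[ℝ] E3)
    {q : ℝ × ℝ × E3} (hy : q.2.2 ≠ 0) (hΔ : r₀ ^ 2 - 2 * q.1 * r₀ + q.2.1 ^ 2 < 0) (v w : E3) :
    ContDiffAt ℝ ∞ (fun q : ℝ × ℝ × E3 ↦ cylKRep q.1 q.2.1 r₀ τ₀ R q.2.2 v w) q := by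
  have hx : 0 < Kerr.radius q.2.1 (kerrCylMap r₀ q.2.1 τ₀ R q.2.2) := by
    rw [radius_kerrCylMap hr₀.le q.2.1 τ₀ R hy]; exact hr₀
  have hM : ContDiffAt ℝ ∞ (fun q : ℝ × ℝ × E3 ↦ kerrCylMap r₀ q.2.1 τ₀ R q.2.2) q :=
    (contDiffAt_kerrCylMap₂ hr₀.ne' τ₀ R (q := q.2) hy).comp q contDiffAt_snd
  have hP : ContDiffAt ℝ ∞
      (fun q : ℝ × ℝ × E3 ↦ (q.1, q.2.1, kerrCylMap r₀ q.2.1 τ₀ R q.2.2)) q :=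
    contDiffAt_fst.prodMk (contDiffAt_snd.fst.prodMk hM)
  have hG : ContDiffAt ℝ ∞
      (fun q : ℝ × ℝ × E3 ↦ Kerr.bilin q.1 q.2.1 (kerrCylMap r₀ q.2.1 τ₀ R q.2.2)) q := by
    have hg := Kerr.contDiffAt_bilin₃ (n := ∞) (q := (q.1, q.2.1, kerrCylMap r₀ q.2.1 τ₀ R q.2.2)) hx
    have h := hg.comp q hP
    exact h
  have hDG : ContDiffAt ℝ ∞ (fun q : ℝ × ℝ × E3 ↦
      fderiv ℝ (Kerr.bilin q.1 q.2.1) (kerrCylMap r₀ q.2.1 τ₀ R q.2.2)) q := by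
    have hg := Kerr.contDiffAt_fderiv_bilin₃ (n := ∞)
      (q := (q.1, q.2.1, kerrCylMap r₀ q.2.1 τ₀ R q.2.2)) hx
    have h := hg.comp q hP
    exact h
  have hD : ContDiffAt ℝ ∞ (fun q : ℝ × ℝ × E3 ↦ kerrCylDeriv r₀ q.2.1 R q.2.2) q :=
    (contDiffAt_kerrCylDeriv₂ hr₀.ne' τ₀ R (q := q.2) hy).comp q contDiffAt_snd
  have hDv : ContDiffAt ℝ ∞ (fun q : ℝ × ℝ × E3 ↦ kerrCylDeriv r₀ q.2.1 R q.2.2 v) q :=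
    hD.clm_apply contDiffAt_const
  have hDw : ContDiffAt ℝ ∞ (fun q : ℝ × ℝ × E3 ↦ kerrCylDeriv r₀ q.2.1 R q.2.2 w) q :=
    hD.clm_apply contDiffAt_const
  have hN := contDiffAt_unitNormal_cyl₃ hr₀ τ₀ R hy hΔ (n := ∞)
  have hDN : ContDiffAt ℝ ∞ (fun q : ℝ × ℝ × E3 ↦
      fderiv ℝ (fun z : E3 ↦ kerrCylUnitNormal q.1 q.2.1 (kerrCylMap r₀ q.2.1 τ₀ R z)) q.2.2 v) q :=
    (contDiffAt_fderiv_unitNormal_cyl₃ hr₀ τ₀ R hy hΔ).clm_apply contDiffAt_const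
  unfold cylKRep
  exact ((hG.clm_apply hDN).clm_apply hDw).add (contDiffAt_const.mul
    (((((hDG.clm_apply hDv).clm_apply hN).clm_apply hDw).add
      (((hDG.clm_apply hN).clm_apply hDw).clm_apply hDv)).sub
      (((hDG.clm_apply hDw).clm_apply hDv).clm_apply hN)))

/-- **The second fundamental form of the Kerr cylinder, `(m, a, y) ↦ cylK₀ m a r₀ τ₀ R y`, is
jointly smooth** (as a form-valued map) off the origin where `Δ_{m,a}(r₀) < 0`.
[cite: LiMei2020, Prop. 4.1] -/
theorem contDiffOn_cylK₀₃ [Kerr.Facts] {r₀ : ℝ} (hr₀ : 0 < r₀) (τ₀ : ℝ) (R : E3 →ₗᵢ[ℝ] E3) :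
    ContDiffOn ℝ ∞ (fun q : ℝ × ℝ × E3 ↦ cylK₀ q.1 q.2.1 hr₀ τ₀ R q.2.2)
      {q : ℝ × ℝ × E3 | q.2.2 ≠ 0 ∧ r₀ ^ 2 - 2 * q.1 * r₀ + q.2.1 ^ 2 < 0} := by
  have hO : IsOpen {q : ℝ × ℝ × E3 | q.2.2 ≠ 0 ∧ r₀ ^ 2 - 2 * q.1 * r₀ + q.2.1 ^ 2 < 0} :=
    (isOpen_ne.preimage (continuous_snd.comp continuous_snd)).inter
      ((isOpen_delta_neg r₀).preimage (continuous_fst.prodMk (continuous_fst.comp continuous_snd)))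
  refine contDiffOn_clm_apply.mpr fun v ↦ contDiffOn_clm_apply.mpr fun w ↦ fun q hq ↦ ?_
  have hev : (fun q : ℝ × ℝ × E3 ↦ cylK₀ q.1 q.2.1 hr₀ τ₀ R q.2.2 v w) =ᶠ[𝓝 q]
      fun q ↦ cylKRep q.1 q.2.1 r₀ τ₀ R q.2.2 v w := by
    filter_upwards [hO.mem_nhds hq] with q' hq'
    exact cylK₀_apply_eq_cylKRep hr₀ hq'.2 τ₀ R hq'.1 v w
  exact ((contDiffAt_cylKRep₃ hr₀ τ₀ R hq.1 hq.2 v w).congr_of_eventuallyEq hev).contDiffWithinAt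

/-! ### Rotations -/

/-- Rotations act on the closed form by precomposition:
`cylKRep[R](y)(v, w) = cylKRep[id](Ry)(Rv, Rw)` (`Δ_{m,a}(r₀) < 0`, `0 < r₀`, `y ≠ 0`).
[folklore] -/
theorem cylKRep_isometry {m a r₀ : ℝ} (hr₀ : 0 < r₀) (hΔ : r₀ ^ 2 - 2 * m * r₀ + a ^ 2 < 0)
    (τ₀ : ℝ) (R : E3 →ₗᵢ[ℝ] E3) {y : E3} (hy : y ≠ 0) (v w : E3) :
    cylKRep m a r₀ τ₀ R y v w = cylKRep m a r₀ τ₀ LinearIsometry.id (R y) (R v) (R w) := by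
  have hRy : R y ≠ 0 := isometry_apply_ne_zero R hy
  have hx : 0 < Kerr.radius a (kerrCylMap r₀ a τ₀ LinearIsometry.id (R y)) := by
    rw [radius_kerrCylMap hr₀.le a τ₀ _ hRy]; exact hr₀
  have hg : DifferentiableAt ℝ
      (fun z : E3 ↦ kerrCylUnitNormal m a (kerrCylMap r₀ a τ₀ LinearIsometry.id z)) (R y) :=
    ((contDiffAt_kerrCylUnitNormal hx
      (bilin_radiusSharp_self_neg_of_delta_neg hr₀ hΔ τ₀ _ hRy) (n := 1)).comp (R y)
      (contDiffAt_kerrCylMap r₀ a τ₀ _ hRy)).differentiableAt one_ne_zero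
  have hcomp : (fun z : E3 ↦ kerrCylUnitNormal m a (kerrCylMap r₀ a τ₀ R z)) =
      (fun z : E3 ↦ kerrCylUnitNormal m a (kerrCylMap r₀ a τ₀ LinearIsometry.id z)) ∘
        R.toContinuousLinearMap := by
    funext z
    simp only [comp_apply, LinearIsometry.coe_toContinuousLinearMap, kerrCylMap_isometry r₀ a τ₀ R z]
  have hD : fderiv ℝ (fun z : E3 ↦ kerrCylUnitNormal m a (kerrCylMap r₀ a τ₀ R z)) y v =
      fderiv ℝ (fun z : E3 ↦ kerrCylUnitNormal m a (kerrCylMap r₀ a τ₀ LinearIsometry.id z))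
        (R y) (R v) := by
    rw [hcomp, fderiv_comp y (by simpa using hg) R.toContinuousLinearMap.differentiableAt,
      R.toContinuousLinearMap.fderiv]
    simp only [ContinuousLinearMap.comp_apply, LinearIsometry.coe_toContinuousLinearMap]
  unfold cylKRep
  rw [hD, kerrCylMap_isometry r₀ a τ₀ R y, kerrCylDeriv_isometry r₀ a R y v,
    kerrCylDeriv_isometry r₀ a R y w]

/-- **Rotations act on the second fundamental form of the Kerr cylinder by precomposition**:
`K[m, a, R](y)(v, w) = K[m, a, id](Ry)(Rv, Rw)` (`Δ_{m,a}(r₀) < 0`). [folklore] -/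
theorem cylK₀_isometry [Kerr.Facts] {m a r₀ : ℝ} (hr₀ : 0 < r₀)
    (hΔ : r₀ ^ 2 - 2 * m * r₀ + a ^ 2 < 0) (τ₀ : ℝ) (R : E3 →ₗᵢ[ℝ] E3) {y : E3} (hy : y ≠ 0)
    (v w : E3) :
    cylK₀ m a hr₀ τ₀ R y v w = cylK₀ m a hr₀ τ₀ LinearIsometry.id (R y) (R v) (R w) := by
  rw [cylK₀_apply_eq_cylKRep hr₀ hΔ τ₀ R hy,
    cylK₀_apply_eq_cylKRep hr₀ hΔ τ₀ _ (isometry_apply_ne_zero R hy), cylKRep_isometry hr₀ hΔ τ₀ R hy]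

/-! ### The estimate -/

/-- **The Kerr-cylinder second fundamental form is `C^k`-close to the Schwarzschild one,
linearly in `|m − M| + |a|`, uniformly in the rotation** (the `π̄`/`k̄` half of Li–Mei's
"`‖(ḡ_{m,a⃗} − ḡ_{m₀}, π̄_{m,a⃗} − π̄_{m₀})‖_{C^k} ≤ C(|m − m₀| + |a⃗|)`", p. 22, with (4.2)): for
`0 < r₀ < 2M`, `1 ≤ ρ₁`, `ρ₂`, `τ₀` and `k` there are `δ > 0` and `C ≥ 0` such that for all
`(m, a)` with `|m − M| + |a| ≤ δ`, every linear isometry `R`, all `v, w` of norm `≤ 1`, all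
`i ≤ k` and all `y` with `ρ₁ < ‖y‖ < ρ₂`,
`‖Dⁱ[z ↦ cylK m a r₀ τ₀ R z v w − kbarRep M r₀ z v w](y)‖ ≤ C (|m − M| + |a|)`
(same proof as the metric half, `exists_norm_iteratedFDeriv_cylH_sub_gbarRep_le`, from the joint
smoothness `contDiffOn_cylK₀₃`, `cylK₀_zero_spin` and `cylK₀_isometry`).
[cite: LiMei2020, proof of Prop. 4.1, p. 22] -/
theorem exists_norm_iteratedFDeriv_cylK_sub_kbarRep_le [Kerr.Facts] {M r₀ : ℝ} (hr₀ : 0 < r₀)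
    (h2M : r₀ < 2 * M) {ρ₁ : ℝ} (hρ₁ : 1 ≤ ρ₁) (ρ₂ τ₀ : ℝ) (k : ℕ) :
    ∃ δ C : ℝ, 0 < δ ∧ 0 ≤ C ∧ ∀ (m a : ℝ), |m - M| + |a| ≤ δ → ∀ (R : E3 →ₗᵢ[ℝ] E3) (v w : E3),
      ‖v‖ ≤ 1 → ‖w‖ ≤ 1 → ∀ i ≤ k, ∀ y : E3, ρ₁ < ‖y‖ → ‖y‖ < ρ₂ →
        ‖iteratedFDeriv ℝ i (fun z : E3 ↦ cylK m a hr₀ τ₀ R z v w - kbarRep M r₀ z v w) y‖ ≤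
          C * (|m - M| + |a|) := by
  obtain ⟨δ, hδ, hbox⟩ := kerrBox hr₀ h2M
  -- `Δ < 0` on the parameter box
  have hΔ : ∀ m a : ℝ, |m - M| + |a| ≤ δ → r₀ ^ 2 - 2 * m * r₀ + a ^ 2 < 0 := fun m a h ↦ by
    obtain ⟨ha, h₁, h₂⟩ := hbox m a h
    exact Kerr.delta_neg ha.le h₁ h₂
  have hsum : ∀ p : ℝ × ℝ, p ∈ closedBall ((M, 0) : ℝ × ℝ) (δ / 2) → |p.1 - M| + |p.2| ≤ δ := by
    intro p hp
    rw [mem_closedBall, dist_eq_norm, Prod.norm_def, max_le_iff] at hp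
    have h1 : |p.1 - M| ≤ δ / 2 := by simpa [Real.norm_eq_abs] using hp.1
    have h2 : |p.2| ≤ δ / 2 := by simpa [Real.norm_eq_abs] using hp.2
    linarith
  -- the smooth family and the compact sets
  set F : (ℝ × ℝ) × E3 → (E3 →L[ℝ] E3 →L[ℝ] ℝ) := fun q ↦
    cylK₀ q.1.1 q.1.2 hr₀ τ₀ LinearIsometry.id q.2 - cylK₀ M 0 hr₀ τ₀ LinearIsometry.id q.2
    with hF_def
  set U : Set ((ℝ × ℝ) × E3) :=
    {q | q.2 ≠ 0 ∧ r₀ ^ 2 - 2 * q.1.1 * r₀ + q.1.2 ^ 2 < 0} with hU_def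
  have hU : IsOpen U :=
    (isOpen_ne.preimage continuous_snd).inter ((isOpen_delta_neg r₀).preimage continuous_fst)
  have hM0 : r₀ ^ 2 - 2 * M * r₀ + (0 : ℝ) ^ 2 < 0 :=
    hΔ M 0 (by rw [sub_self, abs_zero, add_zero]; exact hδ.le)
  have hFs : ∀ q ∈ U, ContDiffAt ℝ ∞ F q := by
    intro q hq
    have h1 : ContDiffAt ℝ ∞
        (fun q : (ℝ × ℝ) × E3 ↦ cylK₀ q.1.1 q.1.2 hr₀ τ₀ LinearIsometry.id q.2) q := by
      have hO : IsOpen {q : ℝ × ℝ × E3 | q.2.2 ≠ 0 ∧ r₀ ^ 2 - 2 * q.1 * r₀ + q.2.1 ^ 2 < 0} :=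
        (isOpen_ne.preimage (continuous_snd.comp continuous_snd)).inter
          ((isOpen_delta_neg r₀).preimage
            (continuous_fst.prodMk (continuous_fst.comp continuous_snd)))
      have hg := (contDiffOn_cylK₀₃ hr₀ τ₀ LinearIsometry.id).contDiffAt
        (hO.mem_nhds (show (q.1.1, q.1.2, q.2) ∈ {q : ℝ × ℝ × E3 |
          q.2.2 ≠ 0 ∧ r₀ ^ 2 - 2 * q.1 * r₀ + q.2.1 ^ 2 < 0} from hq))
      have hf : ContDiffAt ℝ ∞ (fun q : (ℝ × ℝ) × E3 ↦ (q.1.1, q.1.2, q.2)) q :=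
        (contDiffAt_fst.comp q contDiffAt_fst).prodMk
          ((contDiffAt_snd.comp q contDiffAt_fst).prodMk contDiffAt_snd)
      have h := hg.comp q hf
      exact h
    have h2 : ContDiffAt ℝ ∞ (fun q : (ℝ × ℝ) × E3 ↦ cylK₀ M 0 hr₀ τ₀ LinearIsometry.id q.2) q := by
      have hO : IsOpen {q : ℝ × ℝ × E3 | q.2.2 ≠ 0 ∧ r₀ ^ 2 - 2 * q.1 * r₀ + q.2.1 ^ 2 < 0} :=
        (isOpen_ne.preimage (continuous_snd.comp continuous_snd)).inter
          ((isOpen_delta_neg r₀).preimage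
            (continuous_fst.prodMk (continuous_fst.comp continuous_snd)))
      have hq' : ((M, 0, q.2) : ℝ × ℝ × E3) ∈
          {q : ℝ × ℝ × E3 | q.2.2 ≠ 0 ∧ r₀ ^ 2 - 2 * q.1 * r₀ + q.2.1 ^ 2 < 0} := ⟨hq.1, hM0⟩
      have hg := (contDiffOn_cylK₀₃ hr₀ τ₀ LinearIsometry.id).contDiffAt (hO.mem_nhds hq')
      have hf : ContDiffAt ℝ ∞ (fun q : (ℝ × ℝ) × E3 ↦ ((M, 0, q.2) : ℝ × ℝ × E3)) q :=
        contDiffAt_const.prodMk (contDiffAt_const.prodMk contDiffAt_snd)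
      have h := hg.comp q hf
      exact h
    exact h1.sub h2
  have hK : IsCompact (closedBall ((M, 0) : ℝ × ℝ) (δ / 2)) := isCompact_closedBall _ _
  have hKc : Convex ℝ (closedBall ((M, 0) : ℝ × ℝ) (δ / 2)) := convex_closedBall _ _
  have hL : IsCompact {y : E3 | ρ₁ ≤ ‖y‖ ∧ ‖y‖ ≤ ρ₂} :=
    Metric.isCompact_of_isClosed_isBounded
      ((isClosed_le continuous_const continuous_norm).inter
        (isClosed_le continuous_norm continuous_const))
      (isBounded_closedBall.subset fun y hy ↦ mem_closedBall_zero_iff.2 hy.2)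
  have hL0 : ∀ y ∈ {y : E3 | ρ₁ ≤ ‖y‖ ∧ ‖y‖ ≤ ρ₂}, y ≠ 0 := fun y hy h ↦ by
    have h1 : ρ₁ ≤ ‖y‖ := hy.1
    rw [h, norm_zero] at h1
    linarith
  have hKL : closedBall ((M, 0) : ℝ × ℝ) (δ / 2) ×ˢ {y : E3 | ρ₁ ≤ ‖y‖ ∧ ‖y‖ ≤ ρ₂} ⊆ U :=
    fun q hq ↦ ⟨hL0 q.2 hq.2, hΔ q.1.1 q.1.2 (hsum q.1 hq.1)⟩
  have h0 : ∀ y ∈ {y : E3 | ρ₁ ≤ ‖y‖ ∧ ‖y‖ ≤ ρ₂},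
      (fun z ↦ F (((M, 0) : ℝ × ℝ), z)) =ᶠ[𝓝 y] fun _ ↦ 0 :=
    fun y _ ↦ Eventually.of_forall fun z ↦ sub_self _
  obtain ⟨C, hC0, hC⟩ :=
    Literature.Analysis.Calculus.exists_norm_iteratedFDeriv_le_parametric_of_eq_zero hU hFs hK hKc
      hL hKL (mem_closedBall_self (by positivity)) h0 k
  refine ⟨δ / 2, C, by positivity, hC0, fun m a hma R v w hv hw i hi y hy₁ hy₂ ↦ ?_⟩
  have hy0 : y ≠ 0 := fun h ↦ by rw [h, norm_zero] at hy₁; linarith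
  have hp : ((m, a) : ℝ × ℝ) ∈ closedBall ((M, 0) : ℝ × ℝ) (δ / 2) := by
    rw [mem_closedBall, dist_eq_norm, Prod.norm_def]
    refine max_le ?_ ?_
    · show ‖m - M‖ ≤ δ / 2
      rw [Real.norm_eq_abs]; linarith [abs_nonneg a]
    · show ‖a - 0‖ ≤ δ / 2
      rw [sub_zero, Real.norm_eq_abs]; linarith [abs_nonneg (m - M)]
  have hma' : r₀ ^ 2 - 2 * m * r₀ + a ^ 2 < 0 := hΔ m a (by linarith)
  have hRy : R y ∈ {y : E3 | ρ₁ ≤ ‖y‖ ∧ ‖y‖ ≤ ρ₂} := by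
    refine ⟨?_, ?_⟩ <;> rw [LinearIsometry.norm_map] <;> linarith
  have hRy0 : R y ≠ 0 := isometry_apply_ne_zero R hy0
  -- the function near `y` is `evalBilin (Rv) (Rw) ∘ F (m, a) ∘ R`
  have hev : ∀ᶠ z in 𝓝 y, 1 < ‖z‖ :=
    (isOpen_lt continuous_const continuous_norm).mem_nhds (lt_of_le_of_lt hρ₁ hy₁)
  have e1 : (fun z : E3 ↦ cylK m a hr₀ τ₀ R z v w - kbarRep M r₀ z v w) =ᶠ[𝓝 y]
      ((fun z' : E3 ↦ evalBilin (R v) (R w) (F ((m, a), z'))) ∘ isometryEquiv R) := by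
    filter_upwards [hev] with z hz
    have hz0 : z ≠ 0 := fun h ↦ by rw [h, norm_zero] at hz; linarith
    show cylK m a hr₀ τ₀ R z v w - kbarRep M r₀ z v w =
      evalBilin (R v) (R w) (F ((m, a), R z))
    rw [cylK_apply, cylCutoff_of_le_norm hz.le, one_mul, ← cylK₀_zero_spin hr₀ h2M τ₀ R hz v w,
      evalBilin_apply, hF_def]
    simp only [sub_apply]
    rw [cylK₀_isometry hr₀ hma' τ₀ R hz0 v w, cylK₀_isometry hr₀ hM0 τ₀ R hz0 v w]
  rw [(e1.iteratedFDeriv ℝ i).eq_of_nhds,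
    LinearIsometryEquiv.norm_iteratedFDeriv_comp_right (isometryEquiv R) _ y i, coe_isometryEquiv]
  -- `Dⁱ(L ∘ F_p) = L ∘ Dⁱ F_p` on the open set `{z ≠ 0}`
  have hFp : ContDiffOn ℝ ∞ (fun z' : E3 ↦ F ((m, a), z')) {z : E3 | z ≠ 0} := fun z hz ↦ by
    have hg : ContDiffAt ℝ ∞ F (((m, a) : ℝ × ℝ), z) := hFs _ ⟨hz, hma'⟩
    have hf : ContDiffAt ℝ ∞ (fun z' : E3 ↦ (((m, a) : ℝ × ℝ), z')) z :=
      contDiffAt_const.prodMk contDiffAt_id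
    exact (hg.comp z hf).contDiffWithinAt
  have hcomp : iteratedFDeriv ℝ i (fun z' : E3 ↦ evalBilin (R v) (R w) (F ((m, a), z'))) (R y) =
      (evalBilin (R v) (R w)).compContinuousMultilinearMap
        (iteratedFDeriv ℝ i (fun z' : E3 ↦ F ((m, a), z')) (R y)) := by
    rw [← iteratedFDerivWithin_of_isOpen i isOpen_ne hRy0,
      ← iteratedFDerivWithin_of_isOpen i isOpen_ne hRy0]
    exact (evalBilin (R v) (R w)).iteratedFDerivWithin_comp_left (hFp (R y) hRy0)
      isOpen_ne.uniqueDiffOn hRy0 (by exact_mod_cast le_top)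
  rw [hcomp]
  have hmain := hC i hi (m, a) hp (R y) hRy
  have hnorm : ‖((m, a) : ℝ × ℝ) - (M, 0)‖ ≤ |m - M| + |a| := by
    rw [Prod.norm_def]
    refine max_le ?_ ?_
    · show ‖m - M‖ ≤ _
      rw [Real.norm_eq_abs]; linarith [abs_nonneg a]
    · show ‖a - 0‖ ≤ _
      rw [sub_zero, Real.norm_eq_abs]; linarith [abs_nonneg (m - M)]
  have hL1 : ‖evalBilin (R v) (R w)‖ ≤ 1 := by
    refine (norm_evalBilin_le _ _).trans ?_
    rw [LinearIsometry.norm_map, LinearIsometry.norm_map]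
    nlinarith [norm_nonneg v, norm_nonneg w]
  calc ‖(evalBilin (R v) (R w)).compContinuousMultilinearMap
          (iteratedFDeriv ℝ i (fun z' : E3 ↦ F ((m, a), z')) (R y))‖
      ≤ ‖evalBilin (R v) (R w)‖ * ‖iteratedFDeriv ℝ i (fun z' : E3 ↦ F ((m, a), z')) (R y)‖ :=
        ContinuousLinearMap.norm_compContinuousMultilinearMap_le _ _
    _ ≤ 1 * (C * ‖((m, a) : ℝ × ℝ) - (M, 0)‖) :=
        mul_le_mul hL1 hmain (norm_nonneg _) zero_le_one
    _ ≤ C * (|m - M| + |a|) := by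
        rw [one_mul]; exact mul_le_mul_of_nonneg_left hnorm hC0

/-- **The Kerr-cylinder datum is `C(|m − M| + |a|)`-close in `C^k` on the annulus to the
Schwarzschild(`M`) cylinder** — metric AND second fundamental form, i.e. Li–Mei's
"`‖(ḡ_{m,a⃗} − ḡ_{m₀}, π̄_{m,a⃗} − π̄_{m₀})‖_{C^k(A)} ≤ C(|m − m₀| + |a⃗|)`" for the tree's datum:
for `0 < r₁ < r₀ < 2M`, `1 ≤ ρ₁`, `ρ₂`, `τ₀`, `k` there are `δ > 0`, `C ≥ 0` with
`NearSchwarzschildCylinder M r₁ r₀ ρ₁ ρ₂ k (C (|m − M| + |a|)) (kerrCylinderDatum …)` for all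
admissible `(m, a)` with `|m − M| + |a| ≤ δ` and every rotation `R`.
[cite: LiMei2020, proof of Prop. 4.1, p. 22] -/
theorem nearSchwarzschildCylinder_kerrCylinderDatum [Kerr.Facts] {M r₁ r₀ : ℝ} (hr₁ : 0 < r₁)
    (hr₁₀ : r₁ < r₀) (h2M : r₀ < 2 * M) {ρ₁ : ℝ} (hρ₁ : 1 ≤ ρ₁) (ρ₂ τ₀ : ℝ) (k : ℕ) :
    ∃ δ C : ℝ, 0 < δ ∧ 0 ≤ C ∧ ∀ (m a : ℝ) (ha : |a| < m) (h₁ : Kerr.rMinus m a < r₀)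
      (h₂ : r₀ < Kerr.rPlus m a), |m - M| + |a| ≤ δ → ∀ R : E3 →ₗᵢ[ℝ] E3,
        NearSchwarzschildCylinder M r₁ r₀ ρ₁ ρ₂ k (C * (|m - M| + |a|))
          (kerrCylinderDatum ha h₁ h₂ τ₀ R) := by
  have hr₀ : 0 < r₀ := hr₁.trans hr₁₀
  obtain ⟨C₁, hC₁, hh⟩ := exists_norm_iteratedFDeriv_cylH_sub_gbarRep_le M hr₀ hρ₁ ρ₂ τ₀ k
  obtain ⟨δ, C₂, hδ, hC₂, hk⟩ := exists_norm_iteratedFDeriv_cylK_sub_kbarRep_le hr₀ h2M hρ₁ ρ₂ τ₀ k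
  refine ⟨min δ 1, max C₁ C₂, lt_min hδ one_pos, hC₁.trans (le_max_left _ _),
    fun m a ha h₁ h₂ hma R ↦ ?_⟩
  rw [nearSchwarzschildCylinder_iff hr₁₀ hr₀ h2M hρ₁]
  intro v w hv hw i hi y hy₁ hy₂
  have hε : 0 ≤ |m - M| + |a| := by positivity
  refine ⟨?_, ?_⟩
  · calc ‖iteratedFDeriv ℝ i (fun z : E3 ↦ (kerrCylinderDatum ha h₁ h₂ τ₀ R).h.inner z v w -
            gbarRep M r₀ z v w) y‖
        ≤ C₁ * (|m - M| + |a|) :=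
          hh m a (hma.trans (min_le_right _ _)) R v w hv hw i hi y hy₁ hy₂
      _ ≤ max C₁ C₂ * (|m - M| + |a|) := mul_le_mul_of_nonneg_right (le_max_left _ _) hε
  · calc ‖iteratedFDeriv ℝ i (fun z : E3 ↦ (kerrCylinderDatum ha h₁ h₂ τ₀ R).k z v w -
            kbarRep M r₀ z v w) y‖
        ≤ C₂ * (|m - M| + |a|) :=
          hk m a (hma.trans (min_le_left _ _)) R v w hv hw i hi y hy₁ hy₂
      _ ≤ max C₁ C₂ * (|m - M| + |a|) := mul_le_mul_of_nonneg_right (le_max_right _ _) hε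

/-- **The pre-glued datum of the first step is `C(ε + |m − M| + |a|)`-close to the Schwarzschild
cylinder** (Li–Mei p. 22: "`(g̃, π̃) = φ(g, π) + (1 − φ)(ḡ_{m,a⃗}, π̄_{m,a⃗})` is also `ε`-close to
`(ḡ_{m₀}, π̄_{m₀})` … if `|m − m₀| + |a⃗| < C₀ε`"), with constants uniform in the admissible
parameters of the box `|m − M| + |a| ≤ δ` and in the rotation: from
`nearSchwarzschildCylinder_kerrCylinderDatum` and `nearSchwarzschildCylinder_interpolate`.
[cite: LiMei2020, proof of Prop. 4.1, p. 22] -/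
theorem nearSchwarzschildCylinder_preGluedDatum_of_parameters [Kerr.Facts] {M r₁ r₀ : ℝ}
    (hr₁ : 0 < r₁) (hr₁₀ : r₁ < r₀) (h2M : r₀ < 2 * M) {ρ₁ : ℝ} (hρ₁ : 1 ≤ ρ₁)
    (ρ₂ τ₀ σ₁ σ₂ : ℝ) (k : ℕ) :
    ∃ δ C : ℝ, 0 < δ ∧ 0 ≤ C ∧ ∀ (ε : ℝ) (D : InitialDataSet (𝓡 3) E3), 0 ≤ ε →
      NearSchwarzschildCylinder M r₁ r₀ ρ₁ ρ₂ k ε D →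
      ∀ (m a : ℝ) (ha : |a| < m) (h₁ : Kerr.rMinus m a < r₀) (h₂ : r₀ < Kerr.rPlus m a),
        |m - M| + |a| ≤ δ → ∀ R : E3 →ₗᵢ[ℝ] E3,
          NearSchwarzschildCylinder M r₁ r₀ ρ₁ ρ₂ k (C * (ε + (|m - M| + |a|)))
            (preGluedDatum ha h₁ h₂ τ₀ R σ₁ σ₂ D) := by
  have hr₀ : 0 < r₀ := hr₁.trans hr₁₀
  obtain ⟨δ, C₁, hδ, hC₁, hK⟩ := nearSchwarzschildCylinder_kerrCylinderDatum hr₁ hr₁₀ h2M hρ₁ ρ₂ τ₀ k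
  have hbdd : Bornology.IsBounded {z : E3 | ρ₁ < ‖z‖ ∧ ‖z‖ < ρ₂} :=
    Metric.isBounded_ball.subset fun z hz ↦ mem_ball_zero_iff.2 hz.2
  obtain ⟨C₀, hC₀⟩ := exists_bound_iteratedFDeriv (contDiff_radialCutoff (E := E3) σ₁ σ₂) hbdd k
  have hC : ∀ j ≤ k, ∀ y : E3, ρ₁ < ‖y‖ → ‖y‖ < ρ₂ →
      ‖iteratedFDeriv ℝ j (radialCutoff σ₁ σ₂ : E3 → ℝ) y‖ ≤ max C₀ 0 := fun j hj y hy₁ hy₂ ↦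
    (hC₀ j hj y ⟨hy₁, hy₂⟩).trans (le_max_left _ _)
  refine ⟨δ, 2 ^ k * (2 * max C₀ 0 + 1) * max 1 C₁, hδ, by positivity,
    fun ε D hε hD m a ha h₁ h₂ hma R ↦ ?_⟩
  have hma0 : 0 ≤ |m - M| + |a| := by positivity
  -- both data are `ε''`-close with `ε'' = ε + C₁ (|m − M| + |a|)`
  have hD' : NearSchwarzschildCylinder M r₁ r₀ ρ₁ ρ₂ k (ε + C₁ * (|m - M| + |a|)) D :=
    hD.of_le hr₁₀ hr₀ h2M hρ₁ (le_add_of_nonneg_right (mul_nonneg hC₁ hma0))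
  have hK' : NearSchwarzschildCylinder M r₁ r₀ ρ₁ ρ₂ k (ε + C₁ * (|m - M| + |a|))
      (kerrCylinderDatum ha h₁ h₂ τ₀ R) :=
    (hK m a ha h₁ h₂ hma R).of_le hr₁₀ hr₀ h2M hρ₁ (le_add_of_nonneg_left hε)
  have h := nearSchwarzschildCylinder_interpolate hr₁₀ hr₀ h2M hρ₁ (contDiff_radialCutoff σ₁ σ₂)
    (radialCutoff_mem_Icc σ₁ σ₂) hC hD' hK'
  refine h.of_le hr₁₀ hr₀ h2M hρ₁ ?_
  have h1 : ε + C₁ * (|m - M| + |a|) ≤ max 1 C₁ * (ε + (|m - M| + |a|)) := by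
    have e1 : ε ≤ max 1 C₁ * ε := le_mul_of_one_le_left hε (le_max_left _ _)
    have e2 : C₁ * (|m - M| + |a|) ≤ max 1 C₁ * (|m - M| + |a|) :=
      mul_le_mul_of_nonneg_right (le_max_right _ _) hma0
    exact (add_le_add e1 e2).trans_eq (mul_add _ _ _).symm
  calc 2 ^ k * (2 * max C₀ 0 + 1) * (ε + C₁ * (|m - M| + |a|))
      ≤ 2 ^ k * (2 * max C₀ 0 + 1) * (max 1 C₁ * (ε + (|m - M| + |a|))) :=
        mul_le_mul_of_nonneg_left h1 (by positivity)
    _ = 2 ^ k * (2 * max C₀ 0 + 1) * max 1 C₁ * (ε + (|m - M| + |a|)) := by ring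

end LiMei

end Literature.Geometry.Lorentzian

end
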